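import Mathlib
import HarnessLib
import Summits.HubbardSuperconductivity.HubbardSuperconductivity.Theorems.KLProgrammeKLRegimeTwoVolumeSrcStepCovZeroGridRows
import Summits.HubbardSuperconductivity.HubbardSuperconductivity.Theorems.KLProgrammeKLRegimeEngineScaleCutoffAlphaW
import Summits.HubbardSuperconductivity.HubbardSuperconductivity.Theorems.KLProgrammeKLRegimeEngineScaleOneSrcPackageWDoors

/-!
# Route `KLProgramme` — K3 VL child (stmt-HubbardSuperconductivity-23356), atom HUV-W, LEVEL 1 data (ii) INSTANTIATED: the `klScaleWt`-weighted rows and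
# columns of the first step covariance `klStepCov V M β μ K 0` for EVERY admissible frame, from the UV rows at `Λ₂` and `Λ₁` (cell gate-hubbard-kl, p3 g21)

`…TwoVolumeSrcStepCovZeroGridRows.rowColSumWt_klStepCov_zero_of_gridRows` reduces the weighted rows / columns of `klStepCov … 0 = S(F̃_0)ᵀC^K_{(Λ₂,Λ₁]}S(F̃_0)`
to the `gridLabelWt`-weighted rows and columns of the grid-sandwiched UV covariances `S_NᵀC^K_{>Λ_d}S_N`, `d = 2, 1`; those are
`rowSum_/colSum_scaleCutoff_gridLabelWt_le_X5 d` (`…EngineScaleCutoffAlphaW`, any `FrameOK` frame, no window, no history).  This file plugs them in: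

* `exists_abarCutoff_le (d)` — the bracket `Ā(Λ_d; R, N_sc, U)` of the UV rows is `≤ D_d·(1 + ΣGfr)⁴` for an ABSOLUTE `D_d ≥ 1` once `|U| ≤ 1`,
  `(N_sc+1)U² ≤ 1/2` (`bracket_le_abs_mul`);
* **`rowColSumWt_klStepCov_zero_of_frameOK`** — `FrameOK R U Nsc μ K`, `R.WF`, `|U| ≤ 1`, `klBetaMin ≤ β`, `klEngL₃ β U ≤ V`, `klEngM₃ β U V ≤ M`:
  rows and columns (any rate `r`) `≤ 2·(4M/β)·(Ā(Λ₂) + Ā(Λ₁))`;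
* **`exists_alphaWt_klStepCov_zero`** — the packaged form with ONE absolute constant: `∃ D ≥ 1, ∀ R U N_sc μ K β V M r …, rows, cols ≤ (M/β)·(D·(1+ΣGfr)⁴)`
  under `R.WF`, `|U| ≤ 1`, `(N_sc+1)U² ≤ 1/2`, `FrameOK R U N_sc μ K`, the thresholds — the `α = Cb·(M/β)/Λ₂` input of the source block step
  `…SrcTowerBlockF.sourceProfilesAtLevF_blockStep` at `(k, ℓ) = (0, 1)` with `Cb := D·(1+ΣGfr)⁴·Λ₂` (R-keyed, `β`-, `U`-, `L`-, `M`-free).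

Everything is proved; no definitions, no sorry.  Nothing asserts HUV, any stub, VL, K3 or superconductivity.
[cite: BenfattoGiulianiMastropietro2006, §2.8 (2.81), §3 (3.3)]
-/

noncomputable section

namespace Summit.HubbardSuperconductivity.HubbardSuperconductivity.Theorems.TwoVolumeSource

set_option linter.dupNamespace false -- summit = problem name (single-conjunct summit), D-0017

open Finset Literature.MathematicalPhysics.QuantumLattice Literature.Probability.LatticeModels
open Summit.HubbardSuperconductivity.HubbardSuperconductivity.Theorems.KLRegimeSplit
open Summit.HubbardSuperconductivity.HubbardSuperconductivity.Theorems.KLProgrammeLegKernels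
open Summit.HubbardSuperconductivity.HubbardSuperconductivity.Theorems.EngineV8
open Summit.HubbardSuperconductivity.HubbardSuperconductivity.Theorems.ScaleZeroDecay
open Summit.HubbardSuperconductivity.HubbardSuperconductivity.Theorems.TorusFourierL2

/-! ## §1 The UV bracket at `Λ_d` is an absolute constant times `(1 + ΣGfr)⁴` -/

/-- **The bracket of the UV rows at `Λ_d` is `≤ D_d·(1 + ΣGfr)⁴`**, `D_d ≥ 1` absolute (`|U| ≤ 1`, `(N_sc+1)U² ≤ 1/2`). [folklore] -/
theorem exists_abarCutoff_le (d : ℕ) : ∃ D : ℝ, 1 ≤ D ∧ ∀ (R : RenConsts) (U : ℝ) (Nsc : ℕ), R.WF → |U| ≤ 1 → (((Nsc : ℕ) : ℝ) + 1) * U ^ 2 ≤ 1 / 2 →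
    (14 * Real.sqrt ((1 / 2 + 12 / klScale klE0 d) *
            (2 / klScale klE0 d + 128 * Real.pi ^ 4 * (4 * (1110 : ℝ) + 6 * (32 / 3) + 2) ^ 2 / klScale klE0 d +
              2 * Real.pi ^ 5 * (4 * (1110 : ℝ) + 6 * (32 / 3) + 2) ^ 2 / klScale klE0 d ^ 2 + 1 +
              Real.pi ^ 4 * ((7 : ℝ) ^ 2 * (4 * (1110 : ℝ) + 6 * (32 / 3) + 2) * (2 / klScale klE0 d) + 7 * (2 * (32 / 3) + 1)) ^ 2 /
                klScale klE0 d ^ 3))) + uvTimeMomentConst (klScale klE0 d) 7 32 +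
        2 * (uvSpaceMomentConst (klScale klE0 d) 1 (uvPieceSq (klScale klE0 d) (uvBaseQ klCutoffX5 (klScale klE0 d) 4) (uvBaseQ' klCutoffX5 (klScale klE0 d) 4)) +
          (1 / 4 * Real.sqrt (216 * (1 / klScale klE0 d + 1 / 2)) *
              ∑ e : Fin 2 × Fin 2, (uvLinV (klScale klE0 d) (1 + (e.1 : ℕ) + (e.2 : ℕ)) *
                  (klCutoffX5 * ((1 + ((e.1 : ℕ) + (e.2 : ℕ)) + 2).factorial : ℝ) * (4 / klScale klE0 d) ^ (1 + ((e.1 : ℕ) + (e.2 : ℕ)) + 1)) +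
                uvLinD (klScale klE0 d) (1 + (e.1 : ℕ) + (e.2 : ℕ)) *
                  (klCutoffX5 * ((1 + ((e.1 : ℕ) + (e.2 : ℕ)) + 3).factorial : ℝ) * (4 / klScale klE0 d) ^ (1 + ((e.1 : ℕ) + (e.2 : ℕ)) + 2)))) *
            (4608 * (1 + R.Gfr 0 + R.Gfr 1 + R.Gfr 2 + R.Gfr 3) ^ 4 * ((((Nsc : ℕ) : ℝ) + 1) * U ^ 2 + 2 * |U|))) ≤
      D * (1 + R.Gfr 0 + R.Gfr 1 + R.Gfr 2 + R.Gfr 3) ^ 4 := by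
  refine ⟨|14 * Real.sqrt ((1 / 2 + 12 / klScale klE0 d) *
            (2 / klScale klE0 d + 128 * Real.pi ^ 4 * (4 * (1110 : ℝ) + 6 * (32 / 3) + 2) ^ 2 / klScale klE0 d +
              2 * Real.pi ^ 5 * (4 * (1110 : ℝ) + 6 * (32 / 3) + 2) ^ 2 / klScale klE0 d ^ 2 + 1 +
              Real.pi ^ 4 * ((7 : ℝ) ^ 2 * (4 * (1110 : ℝ) + 6 * (32 / 3) + 2) * (2 / klScale klE0 d) + 7 * (2 * (32 / 3) + 1)) ^ 2 /
                klScale klE0 d ^ 3))| + |uvTimeMomentConst (klScale klE0 d) 7 32| +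
        2 * |uvSpaceMomentConst (klScale klE0 d) 1 (uvPieceSq (klScale klE0 d) (uvBaseQ klCutoffX5 (klScale klE0 d) 4) (uvBaseQ' klCutoffX5 (klScale klE0 d) 4))| +
        2 * |1 / 4 * Real.sqrt (216 * (1 / klScale klE0 d + 1 / 2)) *
              ∑ e : Fin 2 × Fin 2, (uvLinV (klScale klE0 d) (1 + (e.1 : ℕ) + (e.2 : ℕ)) *
                  (klCutoffX5 * ((1 + ((e.1 : ℕ) + (e.2 : ℕ)) + 2).factorial : ℝ) * (4 / klScale klE0 d) ^ (1 + ((e.1 : ℕ) + (e.2 : ℕ)) + 1)) +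
                uvLinD (klScale klE0 d) (1 + (e.1 : ℕ) + (e.2 : ℕ)) *
                  (klCutoffX5 * ((1 + ((e.1 : ℕ) + (e.2 : ℕ)) + 3).factorial : ℝ) * (4 / klScale klE0 d) ^ (1 + ((e.1 : ℕ) + (e.2 : ℕ)) + 2)))| *
          (4608 * 3) + 1, le_add_of_nonneg_left (by positivity), fun R U Nsc hR hU1 hN => ?_⟩
  have hG : ∀ j, 0 ≤ R.Gfr j := hR.2.2
  have hg1 : (1 : ℝ) ≤ (1 + R.Gfr 0 + R.Gfr 1 + R.Gfr 2 + R.Gfr 3) ^ 4 := by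
    have : (1 : ℝ) ≤ 1 + R.Gfr 0 + R.Gfr 1 + R.Gfr 2 + R.Gfr 3 := by linarith [hG 0, hG 1, hG 2, hG 3]
    exact one_le_pow₀ this
  have ht : (((Nsc : ℕ) : ℝ) + 1) * U ^ 2 + 2 * |U| ≤ 3 := by linarith [abs_nonneg U]
  have ht0 : 0 ≤ (((Nsc : ℕ) : ℝ) + 1) * U ^ 2 + 2 * |U| := by positivity
  exact bracket_le_abs_mul _ _ _ _ hg1 ht0 ht

/-! ## §2 The weighted rows and columns of `klStepCov … 0` for every admissible frame -/

variable {V M : ℕ} [NeZero V] [NeZero M]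

/-- **The `klScaleWt`-weighted rows and columns of `klStepCov V M β μ K 0` for every admissible frame** (any rate `r`): `≤ 2·((4M/β)·Ā(Λ₂) + (4M/β)·Ā(Λ₁))`
with the explicit UV brackets of `rowSum_scaleCutoff_gridLabelWt_le_X5 2 / 1`.  No depth window, no history.
[cite: BenfattoGiulianiMastropietro2006, §2.8 (2.81), §3 (3.3)] -/
theorem rowColSumWt_klStepCov_zero_of_frameOK {R : RenConsts} {U μ β : ℝ} {Nsc : ℕ} {K : TrigPolyC4v} (hK : FrameOK R U Nsc μ K)
    (hR : R.WF) (hU1 : |U| ≤ 1) (hβ : klBetaMin ≤ β) (hL : klEngL₃ β U ≤ V) (hM : klEngM₃ β U V ≤ M) (r : ℕ) :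
    (∀ Y, ∑ Y', ‖klStepCov V M β μ K 0 Y Y'‖ * klScaleWt V M β r {latticeLegPos (2 * (2 * M)) Y, latticeLegPos (2 * (2 * M)) Y'} ≤
        2 * ((((2 * (2 * M) : ℕ) : ℝ)) / β *
          ((14 * Real.sqrt ((1 / 2 + 12 / (klScale klE0 2)) *
            (2 / (klScale klE0 2) + 128 * Real.pi ^ 4 * (4 * (1110 : ℝ) + 6 * (32 / 3) + 2) ^ 2 / (klScale klE0 2) +
              2 * Real.pi ^ 5 * (4 * (1110 : ℝ) + 6 * (32 / 3) + 2) ^ 2 / (klScale klE0 2) ^ 2 + 1 +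
              Real.pi ^ 4 * ((7 : ℝ) ^ 2 * (4 * (1110 : ℝ) + 6 * (32 / 3) + 2) * (2 / (klScale klE0 2)) + 7 * (2 * (32 / 3) + 1)) ^ 2 /
                (klScale klE0 2) ^ 3))) + uvTimeMomentConst (klScale klE0 2) 7 32 +
          2 * (uvSpaceMomentConst (klScale klE0 2) 1 (uvPieceSq (klScale klE0 2) (uvBaseQ klCutoffX5 (klScale klE0 2) 4) (uvBaseQ' klCutoffX5 (klScale klE0 2) 4)) +
            (1 / 4 * Real.sqrt (216 * (1 / (klScale klE0 2) + 1 / 2)) *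
                ∑ e : Fin 2 × Fin 2, (uvLinV (klScale klE0 2) (1 + (e.1 : ℕ) + (e.2 : ℕ)) *
                    (klCutoffX5 * ((1 + ((e.1 : ℕ) + (e.2 : ℕ)) + 2).factorial : ℝ) * (4 / (klScale klE0 2)) ^ (1 + ((e.1 : ℕ) + (e.2 : ℕ)) + 1)) +
                  uvLinD (klScale klE0 2) (1 + (e.1 : ℕ) + (e.2 : ℕ)) *
                    (klCutoffX5 * ((1 + ((e.1 : ℕ) + (e.2 : ℕ)) + 3).factorial : ℝ) * (4 / (klScale klE0 2)) ^ (1 + ((e.1 : ℕ) + (e.2 : ℕ)) + 2)))) *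
              (4608 * (1 + R.Gfr 0 + R.Gfr 1 + R.Gfr 2 + R.Gfr 3) ^ 4 * (((Nsc : ℝ) + 1) * U ^ 2 + 2 * |U|)))) +
        (((2 * (2 * M) : ℕ) : ℝ)) / β *
          ((14 * Real.sqrt ((1 / 2 + 12 / (klScale klE0 1)) *
            (2 / (klScale klE0 1) + 128 * Real.pi ^ 4 * (4 * (1110 : ℝ) + 6 * (32 / 3) + 2) ^ 2 / (klScale klE0 1) +
              2 * Real.pi ^ 5 * (4 * (1110 : ℝ) + 6 * (32 / 3) + 2) ^ 2 / (klScale klE0 1) ^ 2 + 1 +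
              Real.pi ^ 4 * ((7 : ℝ) ^ 2 * (4 * (1110 : ℝ) + 6 * (32 / 3) + 2) * (2 / (klScale klE0 1)) + 7 * (2 * (32 / 3) + 1)) ^ 2 /
                (klScale klE0 1) ^ 3))) + uvTimeMomentConst (klScale klE0 1) 7 32 +
          2 * (uvSpaceMomentConst (klScale klE0 1) 1 (uvPieceSq (klScale klE0 1) (uvBaseQ klCutoffX5 (klScale klE0 1) 4) (uvBaseQ' klCutoffX5 (klScale klE0 1) 4)) +
            (1 / 4 * Real.sqrt (216 * (1 / (klScale klE0 1) + 1 / 2)) *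
                ∑ e : Fin 2 × Fin 2, (uvLinV (klScale klE0 1) (1 + (e.1 : ℕ) + (e.2 : ℕ)) *
                    (klCutoffX5 * ((1 + ((e.1 : ℕ) + (e.2 : ℕ)) + 2).factorial : ℝ) * (4 / (klScale klE0 1)) ^ (1 + ((e.1 : ℕ) + (e.2 : ℕ)) + 1)) +
                  uvLinD (klScale klE0 1) (1 + (e.1 : ℕ) + (e.2 : ℕ)) *
                    (klCutoffX5 * ((1 + ((e.1 : ℕ) + (e.2 : ℕ)) + 3).factorial : ℝ) * (4 / (klScale klE0 1)) ^ (1 + ((e.1 : ℕ) + (e.2 : ℕ)) + 2)))) *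
              (4608 * (1 + R.Gfr 0 + R.Gfr 1 + R.Gfr 2 + R.Gfr 3) ^ 4 * (((Nsc : ℝ) + 1) * U ^ 2 + 2 * |U|)))))) ∧
    (∀ Y', ∑ Y, ‖klStepCov V M β μ K 0 Y Y'‖ * klScaleWt V M β r {latticeLegPos (2 * (2 * M)) Y, latticeLegPos (2 * (2 * M)) Y'} ≤
        2 * ((((2 * (2 * M) : ℕ) : ℝ)) / β *
          ((14 * Real.sqrt ((1 / 2 + 12 / (klScale klE0 2)) *
            (2 / (klScale klE0 2) + 128 * Real.pi ^ 4 * (4 * (1110 : ℝ) + 6 * (32 / 3) + 2) ^ 2 / (klScale klE0 2) +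
              2 * Real.pi ^ 5 * (4 * (1110 : ℝ) + 6 * (32 / 3) + 2) ^ 2 / (klScale klE0 2) ^ 2 + 1 +
              Real.pi ^ 4 * ((7 : ℝ) ^ 2 * (4 * (1110 : ℝ) + 6 * (32 / 3) + 2) * (2 / (klScale klE0 2)) + 7 * (2 * (32 / 3) + 1)) ^ 2 /
                (klScale klE0 2) ^ 3))) + uvTimeMomentConst (klScale klE0 2) 7 32 +
          2 * (uvSpaceMomentConst (klScale klE0 2) 1 (uvPieceSq (klScale klE0 2) (uvBaseQ klCutoffX5 (klScale klE0 2) 4) (uvBaseQ' klCutoffX5 (klScale klE0 2) 4)) +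
            (1 / 4 * Real.sqrt (216 * (1 / (klScale klE0 2) + 1 / 2)) *
                ∑ e : Fin 2 × Fin 2, (uvLinV (klScale klE0 2) (1 + (e.1 : ℕ) + (e.2 : ℕ)) *
                    (klCutoffX5 * ((1 + ((e.1 : ℕ) + (e.2 : ℕ)) + 2).factorial : ℝ) * (4 / (klScale klE0 2)) ^ (1 + ((e.1 : ℕ) + (e.2 : ℕ)) + 1)) +
                  uvLinD (klScale klE0 2) (1 + (e.1 : ℕ) + (e.2 : ℕ)) *
                    (klCutoffX5 * ((1 + ((e.1 : ℕ) + (e.2 : ℕ)) + 3).factorial : ℝ) * (4 / (klScale klE0 2)) ^ (1 + ((e.1 : ℕ) + (e.2 : ℕ)) + 2)))) *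
              (4608 * (1 + R.Gfr 0 + R.Gfr 1 + R.Gfr 2 + R.Gfr 3) ^ 4 * (((Nsc : ℝ) + 1) * U ^ 2 + 2 * |U|)))) +
        (((2 * (2 * M) : ℕ) : ℝ)) / β *
          ((14 * Real.sqrt ((1 / 2 + 12 / (klScale klE0 1)) *
            (2 / (klScale klE0 1) + 128 * Real.pi ^ 4 * (4 * (1110 : ℝ) + 6 * (32 / 3) + 2) ^ 2 / (klScale klE0 1) +
              2 * Real.pi ^ 5 * (4 * (1110 : ℝ) + 6 * (32 / 3) + 2) ^ 2 / (klScale klE0 1) ^ 2 + 1 +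
              Real.pi ^ 4 * ((7 : ℝ) ^ 2 * (4 * (1110 : ℝ) + 6 * (32 / 3) + 2) * (2 / (klScale klE0 1)) + 7 * (2 * (32 / 3) + 1)) ^ 2 /
                (klScale klE0 1) ^ 3))) + uvTimeMomentConst (klScale klE0 1) 7 32 +
          2 * (uvSpaceMomentConst (klScale klE0 1) 1 (uvPieceSq (klScale klE0 1) (uvBaseQ klCutoffX5 (klScale klE0 1) 4) (uvBaseQ' klCutoffX5 (klScale klE0 1) 4)) +
            (1 / 4 * Real.sqrt (216 * (1 / (klScale klE0 1) + 1 / 2)) *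
                ∑ e : Fin 2 × Fin 2, (uvLinV (klScale klE0 1) (1 + (e.1 : ℕ) + (e.2 : ℕ)) *
                    (klCutoffX5 * ((1 + ((e.1 : ℕ) + (e.2 : ℕ)) + 2).factorial : ℝ) * (4 / (klScale klE0 1)) ^ (1 + ((e.1 : ℕ) + (e.2 : ℕ)) + 1)) +
                  uvLinD (klScale klE0 1) (1 + (e.1 : ℕ) + (e.2 : ℕ)) *
                    (klCutoffX5 * ((1 + ((e.1 : ℕ) + (e.2 : ℕ)) + 3).factorial : ℝ) * (4 / (klScale klE0 1)) ^ (1 + ((e.1 : ℕ) + (e.2 : ℕ)) + 2)))) *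
              (4608 * (1 + R.Gfr 0 + R.Gfr 1 + R.Gfr 2 + R.Gfr 3) ^ 4 * (((Nsc : ℝ) + 1) * U ^ 2 + 2 * |U|)))))) := by
  haveI : NeZero (2 * (2 * M)) := ⟨by have := NeZero.ne M; omega⟩
  have hβ0 : 0 < β := beta_pos_of_klBetaMin_le hβ
  exact rowColSumWt_klStepCov_zero_of_gridRows (V := V) (M := M) hβ0 μ K r
    (rowSum_scaleCutoff_gridLabelWt_le_X5 (L := V) (M := M) 2 hK hR hU1 hβ hL hM) (colSum_scaleCutoff_gridLabelWt_le_X5 (L := V) (M := M) 2 hK hR hU1 hβ hL hM)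
    (rowSum_scaleCutoff_gridLabelWt_le_X5 (L := V) (M := M) 1 hK hR hU1 hβ hL hM) (colSum_scaleCutoff_gridLabelWt_le_X5 (L := V) (M := M) 1 hK hR hU1 hβ hL hM)

/-! ## §3 One absolute constant -/

omit [NeZero V] [NeZero M] in
/-- Pure bookkeeping: `S ≤ 2(N·a + N·b)`, `a ≤ D₂g`, `b ≤ D₁g`, `N = 4c ≥ 0` give `S ≤ c·(8(D₂+D₁)g)`. [folklore] -/
theorem stepCovZero_alpha_bookkeeping {S a b N c D₂ D₁ g : ℝ} (hS : S ≤ 2 * (N * a + N * b)) (ha : a ≤ D₂ * g) (hb : b ≤ D₁ * g)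
    (hN : 0 ≤ N) (hNc : N = 4 * c) : S ≤ c * (8 * (D₂ + D₁) * g) := by
  have h1 : N * a ≤ N * (D₂ * g) := mul_le_mul_of_nonneg_left ha hN
  have h2 : N * b ≤ N * (D₁ * g) := mul_le_mul_of_nonneg_left hb hN
  have : 2 * (N * (D₂ * g) + N * (D₁ * g)) = c * (8 * (D₂ + D₁) * g) := by rw [hNc]; ring
  linarith

/-- **The weighted rows and columns of the first step covariance with ONE absolute constant**: `∃ D ≥ 1` such that for every well-formed `R`,
`|U| ≤ 1`, `(N_sc+1)U² ≤ 1/2`, every admissible frame `FrameOK R U N_sc μ K`, `klBetaMin ≤ β`, `klEngL₃ β U ≤ V`, `klEngM₃ β U V ≤ M` and every rate `r`: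
the `klScaleWt r`-weighted rows and columns of `klStepCov V M β μ K 0` are `≤ (M/β)·(D·(1 + ΣGfr)⁴)` — i.e. `α = Cb·(M/β)/Λ₂` with
`Cb = D·(1+ΣGfr)⁴·Λ₂`, the input of `sourceProfilesAtLevF_blockStep` at `(k, ℓ) = (0, 1)`. [cite: BenfattoGiulianiMastropietro2006, §2.8 (2.81), §3 (3.3)] -/
theorem exists_alphaWt_klStepCov_zero : ∃ D : ℝ, 1 ≤ D ∧
    ∀ (R : RenConsts) (U μ β : ℝ) (Nsc : ℕ) (K : TrigPolyC4v), R.WF → |U| ≤ 1 → (((Nsc : ℕ) : ℝ) + 1) * U ^ 2 ≤ 1 / 2 →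
      FrameOK R U Nsc μ K → klBetaMin ≤ β → ∀ (V M : ℕ) [NeZero V] [NeZero M], klEngL₃ β U ≤ V → klEngM₃ β U V ≤ M → ∀ r : ℕ,
      (∀ Y, ∑ Y', ‖klStepCov V M β μ K 0 Y Y'‖ * klScaleWt V M β r {latticeLegPos (2 * (2 * M)) Y, latticeLegPos (2 * (2 * M)) Y'} ≤
          (M : ℝ) / β * (D * (1 + R.Gfr 0 + R.Gfr 1 + R.Gfr 2 + R.Gfr 3) ^ 4)) ∧
      (∀ Y', ∑ Y, ‖klStepCov V M β μ K 0 Y Y'‖ * klScaleWt V M β r {latticeLegPos (2 * (2 * M)) Y, latticeLegPos (2 * (2 * M)) Y'} ≤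
          (M : ℝ) / β * (D * (1 + R.Gfr 0 + R.Gfr 1 + R.Gfr 2 + R.Gfr 3) ^ 4)) := by
  obtain ⟨D₂, hD₂, h₂⟩ := exists_abarCutoff_le 2
  obtain ⟨D₁, hD₁, h₁⟩ := exists_abarCutoff_le 1
  refine ⟨8 * (D₂ + D₁), by linarith, ?_⟩
  intro R U μ β Nsc K hR hU1 hN hK hβ V M _ _ hL hM r
  have hβ0 : 0 < β := beta_pos_of_klBetaMin_le hβ
  have hM0 : (0 : ℝ) < M := Nat.cast_pos.2 (Nat.pos_of_ne_zero (NeZero.ne M))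
  have hN4 : (((2 * (2 * M) : ℕ) : ℝ)) = 4 * M := by push_cast; ring
  obtain ⟨hrow, hcol⟩ := rowColSumWt_klStepCov_zero_of_frameOK (V := V) (M := M) hK hR hU1 hβ hL hM r
  have hb₂ := h₂ R U Nsc hR hU1 hN
  have hb₁ := h₁ R U Nsc hR hU1 hN
  have hfac : 0 ≤ (((2 * (2 * M) : ℕ) : ℝ)) / β := by positivity
  have hNc : (((2 * (2 * M) : ℕ) : ℝ)) / β = 4 * ((M : ℝ) / β) := by rw [hN4]; ring
  exact ⟨fun Y => stepCovZero_alpha_bookkeeping (hrow Y) hb₂ hb₁ hfac hNc, fun Y' => stepCovZero_alpha_bookkeeping (hcol Y') hb₂ hb₁ hfac hNc⟩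

end Summit.HubbardSuperconductivity.HubbardSuperconductivity.Theorems.TwoVolumeSource

end
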